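import Summits.CriticalPhenomena.PercolationContinuityZ3.Theorems.Transplant.KNCells2Face
import Summits.CriticalPhenomena.PercolationContinuityZ3.Theorems.Transplant.KNLevelsTargetPropertyUniform
import HarnessLib

/-!
# F8 (generic, LAG-1 ANCHORS) — the face input with ONE accuracy `δ₂` for ALL auxiliary graphs on the vertex type
# (p2-g2's `KSchA.cond_of_step`, p217114, fed by stmt's uniform target property `KNLevels.TargetPropertyU`, p217247)

builds on p205010 (kernel theorem, internal audit signed; external expert review pending) — nothing in this file uses p205010.
Lane `prim-bschramm`, seat `prim-bschramm-stmt` (gen 3; p2-g2 12:23Z "your `exists_faceStep_delta` from TargetPropertyU is welcome");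
helper file (`--supports stmt-CriticalPhenomena-4575`).

`cond_of_step` turns one target step (in an auxiliary graph `G'` under the weighting (30)) into the face clause of the node theorem, given the
apply-step conclusion at `(δc/2, δ₂)` FOR THAT `G'`.  In the `X □ ℤ²` scheme with window tube graphs `G' = tubeGraph X π_β` the window moves
with the stub anchor `β`, so `δ₂` — which the node theorem `samePWitnessAt_of_kit₂'` fixes once (`hKε`, `hface`) — must serve every `G'`:
**`exists_delta_cond_of_step`** — from `TargetPropertyU V Δ' p` and `δc > 0`, ONE `δ₂ ∈ (0, 1]` such that for every anchored scheme `S` on `V`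
at `(p, δc)`, every face datum, every `(h, e, α, β, du, j, o)` and every `G'` on `V` with degrees `≤ Δ'`, the hypotheses of `cond_of_step` at
`δ₂` give `cond h e α β du j o`.  (With a fixed `G' = G` the per-graph `TargetProperty.apply_step` suffices; this is the uniform form.)
[cite: KozmaNitzan2024, §4 p. 30 (Step III, (33)); Lemma 10 (p. 17)] [cite: GrimmettPercolation1999, §7.2]
-/

noncomputable section

open MeasureTheory ProbabilityTheory
open scoped ENNReal Classical

namespace Summit.CriticalPhenomena.PercolationContinuityZ3.Theorems

namespace Transplant

namespace KNCells

open Literature.Probability.Percolation Literature.Probability.LatticeModels SimpleGraph GadgetSystem ProbeHistory HSiteScheme Contour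

namespace KSchA

variable {V : Type} [DecidableEq V] {A : Type*}

/-- **ONE `δ₂` for all auxiliary graphs**: from the uniform target property at `(p, Δ')` and `δc > 0`, an accuracy `δ₂ ∈ (0, 1]` (the target
property's `δ` at `δc / 2`) such that p2-g2's `cond_of_step` applies with this `δ₂` in EVERY graph `G'` on `V` with degrees `≤ Δ'`, for every
anchored scheme `S` with `S.p = p`, `S.δc = δc`. [cite: KozmaNitzan2024, §4 p. 30 (Step III, (33)); Lemma 10 (p. 17)] -/
theorem exists_delta_cond_of_step {Δ' : ℕ} {p : unitInterval} (hT : KNLevels.TargetPropertyU V Δ' p) {δc : ℝ} (hδc : 0 < δc) :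
    ∃ δ₂ : ℝ, 0 < δ₂ ∧ δ₂ ≤ 1 ∧ ∀ (G : SimpleGraph V) [G.LocallyFinite] (S : KSchA V A) (FD : FaceData V A), S.p = p → S.δc = δc →
      ∀ (h : ProbeHistory V) (e : Site 2 × MDir) (a a' : A) (du : MDir) (j : ℕ) (o : Finset (Sym2 V))
        (G' : SimpleGraph V) [G'.LocallyFinite], (∀ x, G'.degree x ≤ Δ') →
        ∀ (s : KNLevels.TStep G') (T' : Finset V) (η : ℝ),
        s.L.o = S.Γ.root → s.KitsAt (S.Wt G h e a a' du j o) p Δ' δ₂ → T' ⊆ s.T → T' ⊆ S.Γ.M a' (tgt e + stepVec du) →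
        (prodBernoulli (S.Wt G h e a a' du j o)).real (⋃ t ∈ s.T \ T', openConn S.Γ.root t) ≤ η → η ≤ δc / 2 →
        FD.Face a' (tgt e) du (j + 1) ⊆ s.L.X 0 →
        1 - δ₂ < (prodBernoulli (S.Wt G h e a a' du j o)).real (⋃ b ∈ FD.Face a' (tgt e) du (j + 1), openConn S.Γ.root b) →
          S.cond G h e a a' du j o := by
  obtain ⟨δ₂, hδ₂, hδ₂1, happly⟩ := hT.apply_step (half_pos hδc)
  refine ⟨δ₂, hδ₂, hδ₂1, fun G _ S FD hSp hSδ h e a a' du j o G' _ hΔ' s T' η ho hk hT' hT'M hexc hη hX0 hsrc => ?_⟩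
  subst hSp
  refine cond_of_step (FD := FD) G' (fun W s' hk' hr => ?_) s ho hk T' hT' hT'M hexc (by rw [hSδ]; exact hη) hX0 hsrc
  rw [hSδ]
  exact happly G' hΔ' W s' hk' hr

end KSchA

end KNCells

end Transplant

end Summit.CriticalPhenomena.PercolationContinuityZ3.Theorems

end
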